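import Summits.QuantumFields.BalabanUV.Beta.GAN24.FineReadoutGradientDecay
import Summits.QuantumFields.BalabanUV.Beta.GAN24.FineReadoutSecondDiff

/-!
# `BalabanUV.Beta.GAN24.FineReadoutSecondDiffDecay` — binder row G-an2-4 / (CONV-C), route of record «QR-LL» (OWNER `gan24-p1` g25/g26; row (LT), leaf-01's (F)/(G)),
# THE LOCATED INPUT (N1″) IN THE FORM THAT EXISTS — PART 2, POSITION SPACE: **THE `j`-UNIFORM TWO-STEP SECOND-DIFFERENCE BOUND OF BAŁABAN's MINIMISER COLUMN `ℋ`,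
# `N^{−3/2}` BETTER THAN (N1), WITH DECAY ON THE BLOCK SCALE** — `|ℋ(z+b+c) − ℋ(z+b) − ℋ(z+c) + ℋ(z)| ≤ C″·√‖b‖₁·‖c‖₁·e^{(κ₀/N)(‖b‖₁+‖c‖₁)}·(N^{d+3}·√N)⁻¹·e^{−κ₀‖quo N z‖∞}`
# for EVERY level `N = Lc^(j+1)`, every fine site `z`, every pair of integer steps `b, c` (the twin of leaf-19's `FineReadoutGradientDecay` = (N1′))

NOT IN PRINT; OUR PROOF ATTEMPT (of the road; THIS file is [folklore] packaging — the analytic CONTENT is PART 1b `FineReadoutSecondDiff.norm_sum_ampA_diff2_pw_le`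
((U2‴): two differences gain `N^{−3/2}` in the fibre, King at `α = ±1/2`), fed through pv23's Paley–Wiener `B4ContourShift.latticeKernel_decay` exactly as leaf-19 fed E3A5;
the Bloch dictionary `FineReadoutGradientDecay.blochChar_mul_fibInv_eq_sum` is applied at the FOUR honest lattice points `repZ z₀`, `+b`, `+c`, `+b+c` (no case split on the
box wrap: the block labels `quo N (repZ z₀ + ·)` carry the phases); every level from road P1's (U1)+A = leaf-09's `FibreDetStripHolds.exists_strip` BY NAME).
WHY `N^{−3/2}` AND NOT `N^{−2}`: PART 1a's header — the commissioned `k`-uniform pointwise (N1″) at `(L^{d+4})⁻¹` is EXPECTED FALSE for mixed directions by `log L` at the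
codim-2 block faces (King at `α = 1`; continuum corner computation + scalar toy kit j153041 — NOT a theorem about `wH`; OWNER RULING R-gan24p1-g26-3 withdrew it as a target);
`3/2` is what E3A's method proves and it feeds leaf-01's `LayerPushMoments`/`LayerFrozenCount` sockets (`ha2`/`hb2`, `hF`) verbatim at the cost `√L`.
HONEST FRAMING (cell contract, verbatim): «discharging `BetaPertH` makes Bałaban's UV stability UNCONDITIONAL — a real constructive-QFT result; it is NOT the continuum
limit and NOT the Clay problem.»  HONEST DEPENDENCY (verbatim): «continuum YM on T⁴ ⇐ BetaPertH ∧ nine spine estimates (0/9 proved); BetaPertH ⇐ (D1) ∧ (D4) ∧ CAP+tail;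
G-an2-4 gates asym, D1 and NE2/3/4.»  No cited fact, no wall binder, no `def` (the two-step symbol is WRITTEN OUT in each statement: four `cphase · fibInv` terms), no
`def … : Prop`; discharges NOTHING of (LT) ∕ (Q-R) ∕ (Q-L) ∕ (C) ∕ «T2Shape» ∕ (hW, hWall) — (N1″)_{1/2} is ONE leg-shape input of the pure cell of (LT-3); NEVER «G-an2-4 closed»
as (CONV-C); NOT D1, NOT `BetaPertH`, NOT continuum, NOT Clay.

## What is proved (generic `d`, block side `N ≥ 1`; `wH` = an2's `KernelSpecInstance.wH`, `fibInv` = `CombesThomasFibre.fibInv`; `S_{bc} = √‖b‖₁·‖c‖₁·e^{(η/N)(‖b‖₁+‖c‖₁)}`)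
* §1 **`sum_ampA_diff2_pw_eq`** — THE ALIAS EXPANSION OF THE TWO-STEP SYMBOL: for EVERY complex `p`,
  `Σ_m ampA p v_p m κ · (pw k_m b − 1)(pw k_m c − 1) · pw k_m (repZ z₀) = [x ↦ blochChar p (quo N x)·(F_N(p)⁻¹)_{(κ, proj N x),(Q,l)}]` taken in the combination
  `x = repZ z₀ + (b + c)` minus `+ b` minus `+ c` plus `repZ z₀` (pure DFT, `cfgA_tens_blochChar` ×4 and `pw_add`).
* §2 **`wH_diff2_eq_re_latticeKernel`**: `wH κ l (z+b+c) − wH κ l (z+b) − wH κ l (z+c) + wH κ l z = Re latticeKernel (two-step symbol at proj N z) (quo N z)` (an2's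
  `wH_eq_re_latticeKernel` ×4, pv17's shift rule `latticeKernel_phase_mul`, `latticeKernel_sub`; `det F_N ≠ 0` on a strip of half-width `κ₀ ≥ 0` only for integrability).
* §3 `fineM₂ = e^{(d+1)κ₀}·A·(N^{d+2})⁻¹·(N·√N)⁻¹·4·((π+1)√(π+1) + 10√10·K_D·(R₀²·C_{1/2} + R₀³·C_{−1/2}))` written out (no `def`): `diff2Factor_mono`/`_nonneg`, `norm_diff2Sym_le`,
  **`stripRegular_diff2Sym`**, **`abs_wH_diff2_le`**: under (U1) + scaled a-priori pairs on `Strip (d+1) κ₀` (`0 < κ₀ ≤ 1/4`, `(3(d+1)/2+2)κ₀ ≤ 1/2`),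
  `|wH(z+b+c) − wH(z+b) − wH(z+c) + wH(z)| ≤ fineM₂·S_{bc}·e^{−κ₀‖quo N z‖∞}` for EVERY fine site and every pair of integer steps.
* §4 **`exists_wH_diff2_decay`** (generic `d`, every blocking factor `Lc ≥ 1`, all levels `N = Lc^(j+1)`, ONE `(κ₀, C″)`; inputs leaf-09's `exists_strip` BY NAME, exactly as in
  leaf-19's `exists_wH_grad_decay`): `|wH (N := Lc^(j+1)) κ l (z+b+c) − … + wH κ l z| ≤ C″·(√‖b‖₁·‖c‖₁·e^{(κ₀/Lc^(j+1))(‖b‖₁+‖c‖₁)})·((Lc^(j+1))^{d+3}·√(Lc^(j+1)))⁻¹·e^{−κ₀‖quo z‖∞}`,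
  and at `d = 3` the JOINT form **`exists_wH_decay_grad_diff2`** ((N1) ∧ (N1′) ∧ (N1″)_{1/2} with ONE common rate — the three leg-shape hypotheses of the pure cell of (LT-3)).
Unit `b2b-balaban-gan24-formalise-leaf-02` (G-an2-4 formalisation swarm, leaf prover 02, gen 54; INTENT I-leaf02-g54-1 «N1-TAYLOR», journal l.40624), 2026-08-22.
-/

noncomputable section

open Complex Finset Matrix MeasureTheory
open scoped BigOperators Real Matrix.Norms.L2Operator
open Literature.Probability.LatticeModels (TorusSite Torus.proj)
open Literature.MathematicalPhysics.QuantumFieldTheory.LatticeForm (quo repZ proj_repZ proj_add_zsmul)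
open Literature.MathematicalPhysics.QuantumFieldTheory.Balaban1983to89
open Literature.MathematicalPhysics.QuantumFieldTheory.Balaban1983to89.Beta
open Literature.MathematicalPhysics.QuantumFieldTheory.King1986 (aliasConst)
open B12Sec2to5 (l1 l1_nonneg)
open AffineAveraging (Site)
open B4Strip (Strip reVec)
open B4ContourShift (BZ StripRegular integrand latticeKernel supNorm supNorm_nonneg latticeKernel_decay)
open B4Green244 (latticeKernel_phase_mul)
open B4Green242Bridge (latticeKernel_sub)
open BlochFibreMatrix (Idx stencil pieceMatrix blochChar eq_repZ_add_zsmul_quo)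
open BlochFibreUniqueness (quo_repZ quo_add_zsmul)
open FibreInverseDecay (trigPolySymbol StripHolo cphase stripHolo_cphase stripHolo_const)
open KernelSpecInstance (wH)
open Summit.QuantumFields.BalabanUV.Beta.GAN24.FibreSymbols (pw)
open Summit.QuantumFields.BalabanUV.Beta.GAN24.FibreDFT (kFine)
open Summit.QuantumFields.BalabanUV.Beta.GAN24.FibreDFTDictionary (ampA)
open Summit.QuantumFields.BalabanUV.Beta.GAN24.ArrowOperator (arrowMat)
open Summit.QuantumFields.BalabanUV.Beta.GAN24.ArrowScaling (scaledArrow radI radO radI_pos radO_pos)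
open Summit.QuantumFields.BalabanUV.Beta.GAN24.CombesThomasFibre (fibInv wH_eq_re_latticeKernel)
open Summit.QuantumFields.BalabanUV.Beta.GAN24.StripRegularPackaging (stripHolo_fibInv stripRegular_of_stripHolo)
open Summit.QuantumFields.BalabanUV.Beta.GAN24.FibreDetStripHolds (exists_strip strip_mono)
open Summit.QuantumFields.BalabanUV.Beta.GAN24.FineReadoutDecay (aliasConst_nonneg exists_wH_decay)
open Summit.QuantumFields.BalabanUV.Beta.GAN24.FineReadoutGradientDecay (cphase_eq_blochChar blochChar_mul_fibInv_eq_sum integrableOn_of_stripHolo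
  radO_zero_le_sqrt_mul_pi exists_wH_grad_decay exp_neg_mul_le_of_le)
open Summit.QuantumFields.BalabanUV.Beta.GAN24.FineReadoutSecondDiff (norm_sum_ampA_diff2_pw_le)

namespace Summit.QuantumFields.BalabanUV.Beta.GAN24.FineReadoutSecondDiffDecay

/-! ## §1 The alias expansion of the two-step symbol (pure DFT, every complex quasi-momentum) -/

section Symbol

variable {d N : ℕ} [NeZero N]

/-- [folklore] **THE ALIAS EXPANSION OF THE TWO-STEP SYMBOL** (no case split on the box wrap): for EVERY complex `p` and every pair of integer steps `b, c`,
`Σ_m ampA p v_p m κ · (pw k_m b − 1)(pw k_m c − 1) · pw k_m (repZ z₀)` is the Bloch-dressed minimiser column read at the four lattice points `repZ z₀ (+b) (+c) (+b+c)` with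
signs `+ − − +` — LITERALLY the sum bounded by PART 1b's `norm_sum_ampA_diff2_pw_le`. -/
theorem sum_ampA_diff2_pw_eq (κ l : Fin (d + 1)) (b c : Site (d + 1)) (z₀ : TorusSite (d + 1) N) (p : Fin (d + 1) → ℂ) :
    ∑ m : TorusSite (d + 1) N, ampA p (fun i => fibInv N i (Sum.inr (Sum.inr l)) p) m κ
        * ((pw (kFine p m) b - 1) * (pw (kFine p m) c - 1)) * pw (kFine p m) (repZ z₀)
      = (fun p => cphase (quo N (repZ z₀ + (b + c))) p * fibInv N (Sum.inl (κ, Torus.proj N (repZ z₀ + (b + c)))) (Sum.inr (Sum.inr l)) p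
        - cphase (quo N (repZ z₀ + b)) p * fibInv N (Sum.inl (κ, Torus.proj N (repZ z₀ + b))) (Sum.inr (Sum.inr l)) p
        - cphase (quo N (repZ z₀ + c)) p * fibInv N (Sum.inl (κ, Torus.proj N (repZ z₀ + c))) (Sum.inr (Sum.inr l)) p
        + fibInv N (Sum.inl (κ, z₀)) (Sum.inr (Sum.inr l)) p) p := by
  have hbc := blochChar_mul_fibInv_eq_sum (N := N) κ l p (repZ z₀ + (b + c))
  have hb := blochChar_mul_fibInv_eq_sum (N := N) κ l p (repZ z₀ + b)
  have hc := blochChar_mul_fibInv_eq_sum (N := N) κ l p (repZ z₀ + c)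
  have h0 := blochChar_mul_fibInv_eq_sum (N := N) κ l p (repZ z₀)
  rw [quo_repZ, AddChar.map_zero_eq_one, one_mul, proj_repZ] at h0
  simp only [cphase_eq_blochChar]
  rw [hbc, hb, hc, h0, ← Finset.sum_sub_distrib, ← Finset.sum_sub_distrib, ← Finset.sum_add_distrib]
  refine Finset.sum_congr rfl fun m _ => ?_
  simp only [FibreSymbols.pw_add]
  ring

end Symbol

/-! ## §2 The position-space two-step difference of `ℋ` is the lattice kernel of the two-step symbol -/

section Position

variable {d N : ℕ} [NeZero N]

/-- [folklore] Each dressed term `cphase a · fibInv` is strip holomorphic wherever the fibre determinant has no zero on the strip. -/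
theorem stripHolo_cphase_mul_fibInv {κ₀ : ℝ} (hκ0 : 0 ≤ κ₀)
    (hdet : ∀ p ∈ Strip (d + 1) κ₀, (trigPolySymbol (stencil (d + 1)) (pieceMatrix (N := N)) p).det ≠ 0)
    (κ l : Fin (d + 1)) (a : Site (d + 1)) (w : TorusSite (d + 1) N) :
    StripHolo (fun p => cphase a p * fibInv N (Sum.inl (κ, w)) (Sum.inr (Sum.inr l)) p) κ₀ :=
  (stripHolo_cphase a κ₀).mul (stripHolo_fibInv hκ0 hdet (Sum.inl (κ, w)) (Sum.inr (Sum.inr l)))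

/-- [folklore] The two-step symbol is strip holomorphic wherever the fibre determinant has no zero on the strip. -/
theorem stripHolo_diff2Sym {κ₀ : ℝ} (hκ0 : 0 ≤ κ₀)
    (hdet : ∀ p ∈ Strip (d + 1) κ₀, (trigPolySymbol (stencil (d + 1)) (pieceMatrix (N := N)) p).det ≠ 0)
    (κ l : Fin (d + 1)) (b c : Site (d + 1)) (z₀ : TorusSite (d + 1) N) :
    StripHolo (fun p => cphase (quo N (repZ z₀ + (b + c))) p * fibInv N (Sum.inl (κ, Torus.proj N (repZ z₀ + (b + c)))) (Sum.inr (Sum.inr l)) p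
        - cphase (quo N (repZ z₀ + b)) p * fibInv N (Sum.inl (κ, Torus.proj N (repZ z₀ + b))) (Sum.inr (Sum.inr l)) p
        - cphase (quo N (repZ z₀ + c)) p * fibInv N (Sum.inl (κ, Torus.proj N (repZ z₀ + c))) (Sum.inr (Sum.inr l)) p
        + fibInv N (Sum.inl (κ, z₀)) (Sum.inr (Sum.inr l)) p) κ₀ := by
  have h := (((stripHolo_cphase_mul_fibInv hκ0 hdet κ l (quo N (repZ z₀ + (b + c))) (Torus.proj N (repZ z₀ + (b + c)))).add
      ((stripHolo_const (-1 : ℂ) κ₀).mul (stripHolo_cphase_mul_fibInv hκ0 hdet κ l (quo N (repZ z₀ + b)) (Torus.proj N (repZ z₀ + b))))).add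
      ((stripHolo_const (-1 : ℂ) κ₀).mul (stripHolo_cphase_mul_fibInv hκ0 hdet κ l (quo N (repZ z₀ + c)) (Torus.proj N (repZ z₀ + c))))).add
      (stripHolo_fibInv hκ0 hdet (Sum.inl (κ, z₀)) (Sum.inr (Sum.inr l)))
  have hfun : (fun p => cphase (quo N (repZ z₀ + (b + c))) p * fibInv N (Sum.inl (κ, Torus.proj N (repZ z₀ + (b + c)))) (Sum.inr (Sum.inr l)) p
        - cphase (quo N (repZ z₀ + b)) p * fibInv N (Sum.inl (κ, Torus.proj N (repZ z₀ + b))) (Sum.inr (Sum.inr l)) p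
        - cphase (quo N (repZ z₀ + c)) p * fibInv N (Sum.inl (κ, Torus.proj N (repZ z₀ + c))) (Sum.inr (Sum.inr l)) p
        + fibInv N (Sum.inl (κ, z₀)) (Sum.inr (Sum.inr l)) p)
      = fun p => cphase (quo N (repZ z₀ + (b + c))) p * fibInv N (Sum.inl (κ, Torus.proj N (repZ z₀ + (b + c)))) (Sum.inr (Sum.inr l)) p
          + (-1) * (cphase (quo N (repZ z₀ + b)) p * fibInv N (Sum.inl (κ, Torus.proj N (repZ z₀ + b))) (Sum.inr (Sum.inr l)) p)
          + (-1) * (cphase (quo N (repZ z₀ + c)) p * fibInv N (Sum.inl (κ, Torus.proj N (repZ z₀ + c))) (Sum.inr (Sum.inr l)) p)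
          + fibInv N (Sum.inl (κ, z₀)) (Sum.inr (Sum.inr l)) p := by
    funext p; ring
  rw [hfun]
  exact h

/-- [folklore] One shifted reading of the column: `wH κ l (z + a) = Re latticeKernel (cphase (quo N (repZ z₀ + a)) · fibInv (κ, proj N (repZ z₀ + a))) (quo N z)`, `z₀ = proj N z`
(an2's `wH_eq_re_latticeKernel` + pv17's shift rule; the shifted block label `quo N (z + a) = quo N z + quo N (repZ z₀ + a)` moved into the multiplier). -/
theorem wH_shift_eq_re_latticeKernel (κ l : Fin (d + 1)) (a : Site (d + 1)) (z : Site (d + 1)) :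
    wH (N := N) κ l (z + a) = (latticeKernel (fun p => cphase (quo N (repZ (Torus.proj N z) + a)) p
      * fibInv N (Sum.inl (κ, Torus.proj N (repZ (Torus.proj N z) + a))) (Sum.inr (Sum.inr l)) p) (quo N z)).re := by
  have hz : z + a = repZ (Torus.proj N z) + a + (N : ℤ) • quo N z :=
    calc z + a = repZ (Torus.proj N z) + (N : ℤ) • quo N z + a := congrArg (· + a) (eq_repZ_add_zsmul_quo (N := N) z)
      _ = repZ (Torus.proj N z) + a + (N : ℤ) • quo N z := add_right_comm _ _ _
  rw [wH_eq_re_latticeKernel, hz, proj_add_zsmul, quo_add_zsmul, add_comm (quo N _) (quo N z), ← latticeKernel_phase_mul]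
  rfl

/-- [folklore] **THE TWO-STEP DIFFERENCE OF THE MINIMISER COLUMN IS THE LATTICE KERNEL OF THE TWO-STEP SYMBOL, READ AT THE BLOCK LABEL**
(`det F_N ≠ 0` on a strip of half-width `κ₀ ≥ 0` only for integrability of the four terms). -/
theorem wH_diff2_eq_re_latticeKernel {κ₀ : ℝ} (hκ0 : 0 ≤ κ₀)
    (hdet : ∀ p ∈ Strip (d + 1) κ₀, (trigPolySymbol (stencil (d + 1)) (pieceMatrix (N := N)) p).det ≠ 0)
    (κ l : Fin (d + 1)) (b c : Site (d + 1)) (z : Site (d + 1)) :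
    wH (N := N) κ l (z + (b + c)) - wH (N := N) κ l (z + b) - wH (N := N) κ l (z + c) + wH (N := N) κ l z
      = (latticeKernel (fun p => cphase (quo N (repZ (Torus.proj N z) + (b + c))) p * fibInv N (Sum.inl (κ, Torus.proj N (repZ (Torus.proj N z) + (b + c)))) (Sum.inr (Sum.inr l)) p
        - cphase (quo N (repZ (Torus.proj N z) + b)) p * fibInv N (Sum.inl (κ, Torus.proj N (repZ (Torus.proj N z) + b))) (Sum.inr (Sum.inr l)) p
        - cphase (quo N (repZ (Torus.proj N z) + c)) p * fibInv N (Sum.inl (κ, Torus.proj N (repZ (Torus.proj N z) + c))) (Sum.inr (Sum.inr l)) p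
        + fibInv N (Sum.inl (κ, (Torus.proj N z))) (Sum.inr (Sum.inr l)) p) (quo N z)).re := by
  have sA := stripHolo_cphase_mul_fibInv hκ0 hdet κ l (quo N (repZ (Torus.proj N z) + (b + c))) (Torus.proj N (repZ (Torus.proj N z) + (b + c)))
  have sB := stripHolo_cphase_mul_fibInv hκ0 hdet κ l (quo N (repZ (Torus.proj N z) + b)) (Torus.proj N (repZ (Torus.proj N z) + b))
  have sC := stripHolo_cphase_mul_fibInv hκ0 hdet κ l (quo N (repZ (Torus.proj N z) + c)) (Torus.proj N (repZ (Torus.proj N z) + c))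
  have sD : StripHolo (fun p => fibInv N (Sum.inl (κ, Torus.proj N z)) (Sum.inr (Sum.inr l)) p) κ₀ := stripHolo_fibInv hκ0 hdet (Sum.inl (κ, Torus.proj N z)) (Sum.inr (Sum.inr l))
  have sAB : StripHolo (fun p => (fun p => cphase (quo N (repZ (Torus.proj N z) + (b + c))) p * fibInv N (Sum.inl (κ, Torus.proj N (repZ (Torus.proj N z) + (b + c)))) (Sum.inr (Sum.inr l)) p) p - (fun p => cphase (quo N (repZ (Torus.proj N z) + b)) p * fibInv N (Sum.inl (κ, Torus.proj N (repZ (Torus.proj N z) + b))) (Sum.inr (Sum.inr l)) p) p) κ₀ := by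
    have h := sA.add ((stripHolo_const (-1 : ℂ) κ₀).mul sB)
    refine (show (fun p => (fun p => cphase (quo N (repZ (Torus.proj N z) + (b + c))) p * fibInv N (Sum.inl (κ, Torus.proj N (repZ (Torus.proj N z) + (b + c)))) (Sum.inr (Sum.inr l)) p) p - (fun p => cphase (quo N (repZ (Torus.proj N z) + b)) p * fibInv N (Sum.inl (κ, Torus.proj N (repZ (Torus.proj N z) + b))) (Sum.inr (Sum.inr l)) p) p) = _ from ?_) ▸ h
    funext p; ring
  have sCD : StripHolo (fun p => (fun p => cphase (quo N (repZ (Torus.proj N z) + c)) p * fibInv N (Sum.inl (κ, Torus.proj N (repZ (Torus.proj N z) + c))) (Sum.inr (Sum.inr l)) p) p - (fun p => fibInv N (Sum.inl (κ, Torus.proj N z)) (Sum.inr (Sum.inr l)) p) p) κ₀ := by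
    have h := sC.add ((stripHolo_const (-1 : ℂ) κ₀).mul sD)
    refine (show (fun p => (fun p => cphase (quo N (repZ (Torus.proj N z) + c)) p * fibInv N (Sum.inl (κ, Torus.proj N (repZ (Torus.proj N z) + c))) (Sum.inr (Sum.inr l)) p) p - (fun p => fibInv N (Sum.inl (κ, Torus.proj N z)) (Sum.inr (Sum.inr l)) p) p) = _ from ?_) ▸ h
    funext p; ring
  have iA := integrableOn_of_stripHolo sA hκ0 (quo N z); have iB := integrableOn_of_stripHolo sB hκ0 (quo N z)
  have iC := integrableOn_of_stripHolo sC hκ0 (quo N z); have iD := integrableOn_of_stripHolo sD hκ0 (quo N z)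
  have iAB := integrableOn_of_stripHolo sAB hκ0 (quo N z)
  have iCD := integrableOn_of_stripHolo sCD hκ0 (quo N z)
  have key : latticeKernel (fun p => cphase (quo N (repZ (Torus.proj N z) + (b + c))) p * fibInv N (Sum.inl (κ, Torus.proj N (repZ (Torus.proj N z) + (b + c)))) (Sum.inr (Sum.inr l)) p
        - cphase (quo N (repZ (Torus.proj N z) + b)) p * fibInv N (Sum.inl (κ, Torus.proj N (repZ (Torus.proj N z) + b))) (Sum.inr (Sum.inr l)) p
        - cphase (quo N (repZ (Torus.proj N z) + c)) p * fibInv N (Sum.inl (κ, Torus.proj N (repZ (Torus.proj N z) + c))) (Sum.inr (Sum.inr l)) p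
        + fibInv N (Sum.inl (κ, (Torus.proj N z))) (Sum.inr (Sum.inr l)) p) (quo N z)
      = latticeKernel (fun p => cphase (quo N (repZ (Torus.proj N z) + (b + c))) p * fibInv N (Sum.inl (κ, Torus.proj N (repZ (Torus.proj N z) + (b + c)))) (Sum.inr (Sum.inr l)) p) (quo N z) - latticeKernel (fun p => cphase (quo N (repZ (Torus.proj N z) + b)) p * fibInv N (Sum.inl (κ, Torus.proj N (repZ (Torus.proj N z) + b))) (Sum.inr (Sum.inr l)) p) (quo N z)
        - (latticeKernel (fun p => cphase (quo N (repZ (Torus.proj N z) + c)) p * fibInv N (Sum.inl (κ, Torus.proj N (repZ (Torus.proj N z) + c))) (Sum.inr (Sum.inr l)) p) (quo N z) - latticeKernel (fun p => fibInv N (Sum.inl (κ, Torus.proj N z)) (Sum.inr (Sum.inr l)) p) (quo N z)) := by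
    rw [← latticeKernel_sub _ iA iB, ← latticeKernel_sub _ iC iD, ← latticeKernel_sub _ iAB iCD]
    congr 1
    funext p
    ring
  rw [key, Complex.sub_re, Complex.sub_re, Complex.sub_re, ← wH_shift_eq_re_latticeKernel κ l (b + c) z,
    ← wH_shift_eq_re_latticeKernel κ l b z, ← wH_shift_eq_re_latticeKernel κ l c z,
    show (latticeKernel (fun p => fibInv N (Sum.inl (κ, Torus.proj N z)) (Sum.inr (Sum.inr l)) p) (quo N z)).re = wH (N := N) κ l z from (wH_eq_re_latticeKernel κ l z).symm]
  ring

end Position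

/-! ## §3 The bound on the strip: PART 1b through §1; strip regularity; the pointwise two-step bound -/

section Bound

variable {d N : ℕ} [NeZero N]

/-- [folklore] The `d`-dependent factor of (U2‴) at border-radius envelope `R₀` — `(π+1)√(π+1) + 10√10·K_D·(R₀²·C_{1/2} + R₀³·C_{−1/2})` — is monotone in `R₀ ≥ 0`. -/
theorem diff2Factor_mono {R0 R0' : ℝ} (h0 : 0 ≤ R0) (h : R0 ≤ R0') :
    ((π + 1) * Real.sqrt (π + 1) + 10 * Real.sqrt 10 * (Real.sqrt 12 ^ (d + 1) * (Real.sqrt 6 * (1 + 8 * (d + 1 : ℕ)))) * (R0 ^ 2 * ((3 * π) ^ (1 - (1 / 2 : ℝ)) * (3 : ℝ) ^ (d + 1) * aliasConst (d + 1) (1 / 2)) + R0 ^ 3 * ((3 * π) ^ (1 - (-(1 / 2) : ℝ)) * (3 : ℝ) ^ (d + 1) * aliasConst (d + 1) (-(1 / 2)))))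
      ≤ ((π + 1) * Real.sqrt (π + 1) + 10 * Real.sqrt 10 * (Real.sqrt 12 ^ (d + 1) * (Real.sqrt 6 * (1 + 8 * (d + 1 : ℕ)))) * (R0' ^ 2 * ((3 * π) ^ (1 - (1 / 2 : ℝ)) * (3 : ℝ) ^ (d + 1) * aliasConst (d + 1) (1 / 2)) + R0' ^ 3 * ((3 * π) ^ (1 - (-(1 / 2) : ℝ)) * (3 : ℝ) ^ (d + 1) * aliasConst (d + 1) (-(1 / 2))))) := by
  have hC0 : 0 ≤ ((3 * π) ^ (1 - (1 / 2 : ℝ)) * (3 : ℝ) ^ (d + 1) * aliasConst (d + 1) (1 / 2)) :=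
    mul_nonneg (by positivity) (aliasConst_nonneg (Nat.succ_pos d) (by norm_num))
  have hC1 : 0 ≤ ((3 * π) ^ (1 - (-(1 / 2) : ℝ)) * (3 : ℝ) ^ (d + 1) * aliasConst (d + 1) (-(1 / 2))) :=
    mul_nonneg (by positivity) (aliasConst_nonneg (Nat.succ_pos d) (by norm_num))
  have h2 : R0 ^ 2 ≤ R0' ^ 2 := pow_le_pow_left₀ h0 h 2
  have h3 : R0 ^ 3 ≤ R0' ^ 3 := pow_le_pow_left₀ h0 h 3
  have hK : 0 ≤ 10 * Real.sqrt 10 * (Real.sqrt 12 ^ (d + 1) * (Real.sqrt 6 * (1 + 8 * (d + 1 : ℕ)))) := by positivity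
  nlinarith [mul_le_mul_of_nonneg_right h2 hC0, mul_le_mul_of_nonneg_right h3 hC1]

/-- [folklore] … and nonnegative for `R₀ ≥ 0`. -/
theorem diff2Factor_nonneg {R0 : ℝ} (h0 : 0 ≤ R0) :
    0 ≤ ((π + 1) * Real.sqrt (π + 1) + 10 * Real.sqrt 10 * (Real.sqrt 12 ^ (d + 1) * (Real.sqrt 6 * (1 + 8 * (d + 1 : ℕ)))) * (R0 ^ 2 * ((3 * π) ^ (1 - (1 / 2 : ℝ)) * (3 : ℝ) ^ (d + 1) * aliasConst (d + 1) (1 / 2)) + R0 ^ 3 * ((3 * π) ^ (1 - (-(1 / 2) : ℝ)) * (3 : ℝ) ^ (d + 1) * aliasConst (d + 1) (-(1 / 2))))) := by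
  have hC0 : 0 ≤ ((3 * π) ^ (1 - (1 / 2 : ℝ)) * (3 : ℝ) ^ (d + 1) * aliasConst (d + 1) (1 / 2)) :=
    mul_nonneg (by positivity) (aliasConst_nonneg (Nat.succ_pos d) (by norm_num))
  have hC1 : 0 ≤ ((3 * π) ^ (1 - (-(1 / 2) : ℝ)) * (3 : ℝ) ^ (d + 1) * aliasConst (d + 1) (-(1 / 2))) :=
    mul_nonneg (by positivity) (aliasConst_nonneg (Nat.succ_pos d) (by norm_num))
  positivity

/-- [folklore] **(U2‴) AT A STRIP POINT, IN POSITION-READY FORM**: with a scaled a-priori pair of border radius `r₀ ≤ R₀` at `p ∈ Strip (d+1) κ₀`,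
`‖two-step symbol at p‖ ≤ fineM₂(R₀)·S_{bc}`, `fineM₂ = e^{(d+1)κ₀}·A·(N^{d+2})⁻¹·(N·√N)⁻¹·4·diff2Factor(R₀)`, `S_{bc} = √‖b‖₁·‖c‖₁·e^{(κ₀/N)(‖b‖₁+‖c‖₁)}`
(`sum_ampA_diff2_pw_eq` + PART 1b's `norm_sum_ampA_diff2_pw_le` + monotonicity in `r₀`). -/
theorem norm_diff2Sym_le {κ₀ A R0 : ℝ} (hκ : 0 ≤ κ₀) (hκ4 : κ₀ ≤ 1 / 4) (hκD : (3 * (d + 1 : ℕ) / 2 + 2) * κ₀ ≤ 1 / 2) (hA : 0 ≤ A)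
    {p : Fin (d + 1) → ℂ} (hp : p ∈ Strip (d + 1) κ₀) (hdet : (trigPolySymbol (stencil (d + 1)) (pieceMatrix (N := N)) p).det ≠ 0)
    {r : TorusSite (d + 1) N → ℝ} (hr : ∀ m, 0 < r m) {r0 : ℝ} (hr0 : 0 < r0) (hr0R : r0 ≤ R0)
    (hU : IsUnit (arrowMat (scaledArrow N r r0 p))) (hAi : ‖(arrowMat (scaledArrow N r r0 p))⁻¹‖ ≤ A)
    (κ l : Fin (d + 1)) (b c : Site (d + 1)) (z₀ : TorusSite (d + 1) N) :
    ‖(fun p => cphase (quo N (repZ z₀ + (b + c))) p * fibInv N (Sum.inl (κ, Torus.proj N (repZ z₀ + (b + c)))) (Sum.inr (Sum.inr l)) p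
        - cphase (quo N (repZ z₀ + b)) p * fibInv N (Sum.inl (κ, Torus.proj N (repZ z₀ + b))) (Sum.inr (Sum.inr l)) p
        - cphase (quo N (repZ z₀ + c)) p * fibInv N (Sum.inl (κ, Torus.proj N (repZ z₀ + c))) (Sum.inr (Sum.inr l)) p
        + fibInv N (Sum.inl (κ, z₀)) (Sum.inr (Sum.inr l)) p) p‖
      ≤ (Real.exp ((d + 1) * κ₀) * A * ((N : ℝ) ^ (d + 1 + 1))⁻¹ * ((N : ℝ) * Real.sqrt N)⁻¹ * (4 * ((π + 1) * Real.sqrt (π + 1) + 10 * Real.sqrt 10 * (Real.sqrt 12 ^ (d + 1) * (Real.sqrt 6 * (1 + 8 * (d + 1 : ℕ)))) * (R0 ^ 2 * ((3 * π) ^ (1 - (1 / 2 : ℝ)) * (3 : ℝ) ^ (d + 1) * aliasConst (d + 1) (1 / 2)) + R0 ^ 3 * ((3 * π) ^ (1 - (-(1 / 2) : ℝ)) * (3 : ℝ) ^ (d + 1) * aliasConst (d + 1) (-(1 / 2)))))))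
        * (Real.sqrt (l1 b) * l1 c * Real.exp (κ₀ / N * (l1 b + l1 c))) := by
  rw [← sum_ampA_diff2_pw_eq]
  have hb0 := l1_nonneg b
  have hc0 := l1_nonneg c
  have h := norm_sum_ampA_diff2_pw_le (fun i => (hp i).1) (fun i => (hp i).2) hκ hκ4 hκD hdet hr hr0 hA hU hAi l κ b c z₀
  refine h.trans ?_
  have hK := diff2Factor_mono (d := d) hr0.le hr0R
  have hE : 0 ≤ Real.exp ((d + 1) * κ₀) * A * ((N : ℝ) ^ (d + 1 + 1))⁻¹ * ((N : ℝ) * Real.sqrt N)⁻¹ * (4 * (Real.sqrt (l1 b) * l1 c * Real.exp (κ₀ / N * (l1 b + l1 c)))) := by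
    positivity
  calc _ = Real.exp ((d + 1) * κ₀) * A * ((N : ℝ) ^ (d + 1 + 1))⁻¹ * ((N : ℝ) * Real.sqrt N)⁻¹ * (4 * (Real.sqrt (l1 b) * l1 c * Real.exp (κ₀ / N * (l1 b + l1 c))))
          * ((π + 1) * Real.sqrt (π + 1) + 10 * Real.sqrt 10 * (Real.sqrt 12 ^ (d + 1) * (Real.sqrt 6 * (1 + 8 * (d + 1 : ℕ)))) * (r0 ^ 2 * ((3 * π) ^ (1 - (1 / 2 : ℝ)) * (3 : ℝ) ^ (d + 1) * aliasConst (d + 1) (1 / 2)) + r0 ^ 3 * ((3 * π) ^ (1 - (-(1 / 2) : ℝ)) * (3 : ℝ) ^ (d + 1) * aliasConst (d + 1) (-(1 / 2))))) := by ring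
    _ ≤ Real.exp ((d + 1) * κ₀) * A * ((N : ℝ) ^ (d + 1 + 1))⁻¹ * ((N : ℝ) * Real.sqrt N)⁻¹ * (4 * (Real.sqrt (l1 b) * l1 c * Real.exp (κ₀ / N * (l1 b + l1 c))))
          * ((π + 1) * Real.sqrt (π + 1) + 10 * Real.sqrt 10 * (Real.sqrt 12 ^ (d + 1) * (Real.sqrt 6 * (1 + 8 * (d + 1 : ℕ)))) * (R0 ^ 2 * ((3 * π) ^ (1 - (1 / 2 : ℝ)) * (3 : ℝ) ^ (d + 1) * aliasConst (d + 1) (1 / 2)) + R0 ^ 3 * ((3 * π) ^ (1 - (-(1 / 2) : ℝ)) * (3 : ℝ) ^ (d + 1) * aliasConst (d + 1) (-(1 / 2))))) := mul_le_mul_of_nonneg_left hK hE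
    _ = _ := by ring

/-- [folklore] **`StripRegular` OF THE TWO-STEP SYMBOL** from a det-free strip carrying scaled a-priori pairs (inner or outer, border radius `≤ R₀`). -/
theorem stripRegular_diff2Sym {κ₀ A R0 : ℝ} (hκ0 : 0 < κ₀) (hκ4 : κ₀ ≤ 1 / 4) (hκD : (3 * (d + 1 : ℕ) / 2 + 2) * κ₀ ≤ 1 / 2)
    (hA : 0 ≤ A) (_hR0 : 0 < R0)
    (hdet : ∀ p ∈ Strip (d + 1) κ₀, (trigPolySymbol (stencil (d + 1)) (pieceMatrix (N := N)) p).det ≠ 0)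
    (hpair : ∀ p ∈ Strip (d + 1) κ₀, ∃ (r : TorusSite (d + 1) N → ℝ) (r0 : ℝ), (∀ m, 0 < r m) ∧ 0 < r0 ∧ r0 ≤ R0 ∧
      IsUnit (arrowMat (scaledArrow N r r0 p)) ∧ ‖(arrowMat (scaledArrow N r r0 p))⁻¹‖ ≤ A)
    (κ l : Fin (d + 1)) (b c : Site (d + 1)) (z₀ : TorusSite (d + 1) N) :
    StripRegular (fun p => cphase (quo N (repZ z₀ + (b + c))) p * fibInv N (Sum.inl (κ, Torus.proj N (repZ z₀ + (b + c)))) (Sum.inr (Sum.inr l)) p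
        - cphase (quo N (repZ z₀ + b)) p * fibInv N (Sum.inl (κ, Torus.proj N (repZ z₀ + b))) (Sum.inr (Sum.inr l)) p
        - cphase (quo N (repZ z₀ + c)) p * fibInv N (Sum.inl (κ, Torus.proj N (repZ z₀ + c))) (Sum.inr (Sum.inr l)) p
        + fibInv N (Sum.inl (κ, z₀)) (Sum.inr (Sum.inr l)) p) κ₀
      ((Real.exp ((d + 1) * κ₀) * A * ((N : ℝ) ^ (d + 1 + 1))⁻¹ * ((N : ℝ) * Real.sqrt N)⁻¹ * (4 * ((π + 1) * Real.sqrt (π + 1) + 10 * Real.sqrt 10 * (Real.sqrt 12 ^ (d + 1) * (Real.sqrt 6 * (1 + 8 * (d + 1 : ℕ)))) * (R0 ^ 2 * ((3 * π) ^ (1 - (1 / 2 : ℝ)) * (3 : ℝ) ^ (d + 1) * aliasConst (d + 1) (1 / 2)) + R0 ^ 3 * ((3 * π) ^ (1 - (-(1 / 2) : ℝ)) * (3 : ℝ) ^ (d + 1) * aliasConst (d + 1) (-(1 / 2)))))))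
        * (Real.sqrt (l1 b) * l1 c * Real.exp (κ₀ / N * (l1 b + l1 c)))) := by
  refine stripRegular_of_stripHolo (stripHolo_diff2Sym hκ0.le hdet κ l b c z₀) fun p hp => ?_
  obtain ⟨r, r0, hr, hr0, hr0R, hU, hAi⟩ := hpair p hp
  exact norm_diff2Sym_le hκ0.le hκ4 hκD hA hp (hdet p hp) hr hr0 hr0R hU hAi κ l b c z₀

/-- [folklore] **(N1″)_{1/2} AT BLOCK SIDE `N`**: Paley–Wiener on the block label —
`|wH κ l (z+b+c) − wH κ l (z+b) − wH κ l (z+c) + wH κ l z| ≤ fineM₂(R₀)·S_{bc}·e^{−κ₀‖quo N z‖∞}` for EVERY fine site `z` and every pair of integer steps `b, c`. -/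
theorem abs_wH_diff2_le {κ₀ A R0 : ℝ} (hκ0 : 0 < κ₀) (hκ4 : κ₀ ≤ 1 / 4) (hκD : (3 * (d + 1 : ℕ) / 2 + 2) * κ₀ ≤ 1 / 2)
    (hA : 0 ≤ A) (hR0 : 0 < R0)
    (hdet : ∀ p ∈ Strip (d + 1) κ₀, (trigPolySymbol (stencil (d + 1)) (pieceMatrix (N := N)) p).det ≠ 0)
    (hpair : ∀ p ∈ Strip (d + 1) κ₀, ∃ (r : TorusSite (d + 1) N → ℝ) (r0 : ℝ), (∀ m, 0 < r m) ∧ 0 < r0 ∧ r0 ≤ R0 ∧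
      IsUnit (arrowMat (scaledArrow N r r0 p)) ∧ ‖(arrowMat (scaledArrow N r r0 p))⁻¹‖ ≤ A)
    (κ l : Fin (d + 1)) (b c : Site (d + 1)) (z : Site (d + 1)) :
    |wH (N := N) κ l (z + (b + c)) - wH (N := N) κ l (z + b) - wH (N := N) κ l (z + c) + wH (N := N) κ l z|
      ≤ (Real.exp ((d + 1) * κ₀) * A * ((N : ℝ) ^ (d + 1 + 1))⁻¹ * ((N : ℝ) * Real.sqrt N)⁻¹ * (4 * ((π + 1) * Real.sqrt (π + 1) + 10 * Real.sqrt 10 * (Real.sqrt 12 ^ (d + 1) * (Real.sqrt 6 * (1 + 8 * (d + 1 : ℕ)))) * (R0 ^ 2 * ((3 * π) ^ (1 - (1 / 2 : ℝ)) * (3 : ℝ) ^ (d + 1) * aliasConst (d + 1) (1 / 2)) + R0 ^ 3 * ((3 * π) ^ (1 - (-(1 / 2) : ℝ)) * (3 : ℝ) ^ (d + 1) * aliasConst (d + 1) (-(1 / 2)))))))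
        * (Real.sqrt (l1 b) * l1 c * Real.exp (κ₀ / N * (l1 b + l1 c))) * Real.exp (-(κ₀ * supNorm (quo N z))) := by
  rw [wH_diff2_eq_re_latticeKernel hκ0.le hdet]
  refine (Complex.abs_re_le_norm _).trans ?_
  exact latticeKernel_decay (stripRegular_diff2Sym hκ0 hκ4 hκD hA hR0 hdet hpair κ l b c (Torus.proj N z)) hκ0.le _

end Bound

/-! ## §4 Every level, unconditionally, from road P1's (U1)+A: (N1″)_{1/2}; and the joint (N1) ∧ (N1′) ∧ (N1″)_{1/2} at `d = 3` -/

section Levels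

variable {d Lc : ℕ} [NeZero Lc]

/-- [folklore] **(N1″)_{1/2}, UNCONDITIONAL, EVERY `d`, EVERY PAIR OF INTEGER STEPS**: ONE rate `κ₀ > 0` and ONE constant `C″` such that for EVERY level `N = Lc^(j+1)`,
every fine site `z`, every reading `κ`, source `l` and steps `b, c ∈ ℤ^{d+1}`,
`|wH(z+b+c) − wH(z+b) − wH(z+c) + wH(z)| ≤ C″·(√‖b‖₁·‖c‖₁·e^{(‖b‖₁+‖c‖₁)/(4N)})·(N^{d+3}·√N)⁻¹·e^{−κ₀‖quo N z‖∞}` — `O(N^{−(d+3)−1/2})` pointwise with exponential decay on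
the BLOCK scale, uniformly in the level (leaf-09's `exists_strip` BY NAME; strip shrunk to `κ₁ = min κ₀ (1/(3(d+1)+4)) ≤ 1/4`, whence the rate-free step factor;
`R₀ = √(d+1)·π`).  NOT `O(N^{−(d+4)})`: expected false for mixed steps by `log N` (PART 1a's header; R-gan24p1-g26-3). -/
theorem exists_wH_diff2_decay :
    ∃ κ₀ C'' : ℝ, 0 < κ₀ ∧ 0 ≤ C'' ∧ ∀ (j : ℕ) (κ l : Fin (d + 1)) (z b c : Site (d + 1)),
      |wH (N := Lc ^ (j + 1)) κ l (z + (b + c)) - wH (N := Lc ^ (j + 1)) κ l (z + b) - wH (N := Lc ^ (j + 1)) κ l (z + c)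
          + wH (N := Lc ^ (j + 1)) κ l z|
        ≤ C'' * (Real.sqrt (l1 b) * l1 c * Real.exp ((l1 b + l1 c) / (4 * (((Lc ^ (j + 1) : ℕ) : ℝ)))))
          * ((((Lc ^ (j + 1) : ℕ) : ℝ)) ^ (d + 3) * Real.sqrt (((Lc ^ (j + 1) : ℕ) : ℝ)))⁻¹
          * Real.exp (-(κ₀ * supNorm (quo (Lc ^ (j + 1)) z))) := by
  obtain ⟨ρ₀, κ₀, A, hρ₀, hκ₀, _hκρ, hκ4, hA, hdet, hpair⟩ := exists_strip (d := d) (Lc := Lc)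
  -- shrink the strip so that E3A2's relative bound applies: (3(d+1)/2 + 2)·κ₁ ≤ 1/2
  set T : ℝ := 3 * ((d + 1 : ℕ) : ℝ) + 4 with hT
  have hTpos : 0 < T := by rw [hT]; positivity
  have hT7 : 7 ≤ T := by
    rw [hT]; have : (1 : ℝ) ≤ ((d + 1 : ℕ) : ℝ) := by exact_mod_cast Nat.succ_pos d
    linarith
  set κ₁ : ℝ := min κ₀ (1 / T) with hκ₁
  have hκ₁0 : 0 < κ₁ := lt_min hκ₀ (by positivity)
  have hκ₁le : κ₁ ≤ κ₀ := min_le_left _ _; have hκ₁T : κ₁ ≤ 1 / T := min_le_right _ _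
  have hκ₁4 : κ₁ ≤ 1 / 4 := hκ₁T.trans (one_div_le_one_div_of_le (by norm_num) (by linarith))
  have hκ₁D : (3 * (d + 1 : ℕ) / 2 + 2) * κ₁ ≤ 1 / 2 := by
    have h1 : (3 * ((d + 1 : ℕ) : ℝ) / 2 + 2) = T / 2 := by rw [hT]; ring
    rw [h1]
    calc T / 2 * κ₁ ≤ T / 2 * (1 / T) := mul_le_mul_of_nonneg_left hκ₁T (by positivity)
      _ = 1 / 2 := by field_simp
  set R0 : ℝ := Real.sqrt ((d + 1 : ℕ) : ℝ) * π with hR0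
  have hR0one : 1 ≤ R0 := by
    rw [hR0]
    have h1 : 1 ≤ Real.sqrt ((d + 1 : ℕ) : ℝ) := Real.one_le_sqrt.2 (by exact_mod_cast Nat.succ_pos d)
    have hπ := Real.pi_gt_three
    nlinarith
  have hR0pos : 0 < R0 := lt_of_lt_of_le one_pos hR0one
  refine ⟨κ₁, Real.exp ((d + 1) * κ₁) * A * (4 * ((π + 1) * Real.sqrt (π + 1) + 10 * Real.sqrt 10 * (Real.sqrt 12 ^ (d + 1) * (Real.sqrt 6 * (1 + 8 * (d + 1 : ℕ)))) * (R0 ^ 2 * ((3 * π) ^ (1 - (1 / 2 : ℝ)) * (3 : ℝ) ^ (d + 1) * aliasConst (d + 1) (1 / 2)) + R0 ^ 3 * ((3 * π) ^ (1 - (-(1 / 2) : ℝ)) * (3 : ℝ) ^ (d + 1) * aliasConst (d + 1) (-(1 / 2)))))), hκ₁0, ?_, fun j κ l z b c => ?_⟩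
  · have := diff2Factor_nonneg (d := d) hR0pos.le; positivity
  haveI : NeZero (Lc ^ (j + 1)) := ⟨pow_ne_zero _ (NeZero.ne Lc)⟩
  have hN : (0 : ℝ) < ((Lc ^ (j + 1) : ℕ) : ℝ) := by exact_mod_cast Nat.pos_of_ne_zero (NeZero.ne (Lc ^ (j + 1)))
  have hdet₁ : ∀ p ∈ Strip (d + 1) κ₁, (trigPolySymbol (stencil (d + 1)) (pieceMatrix (N := Lc ^ (j + 1))) p).det ≠ 0 :=
    strip_mono hκ₁le (hdet j)
  have hpair₁ : ∀ p ∈ Strip (d + 1) κ₁, ∃ (r : TorusSite (d + 1) (Lc ^ (j + 1)) → ℝ) (r0 : ℝ), (∀ m, 0 < r m) ∧ 0 < r0 ∧ r0 ≤ R0 ∧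
      IsUnit (arrowMat (scaledArrow (Lc ^ (j + 1)) r r0 p)) ∧ ‖(arrowMat (scaledArrow (Lc ^ (j + 1)) r r0 p))⁻¹‖ ≤ A := by
    intro p hp
    have hq : ∀ i, |reVec p i| ≤ π := fun i => (hp i).1
    rcases strip_mono hκ₁le (hpair j) p hp with ⟨_, hU, hAi⟩ | ⟨_, _, hq0, hU, hAi⟩
    · exact ⟨radI (Lc ^ (j + 1)), 1, radI_pos, one_pos, hR0one, hU, hAi⟩
    · exact ⟨radO (Lc ^ (j + 1)) (reVec p), radO (Lc ^ (j + 1)) (reVec p) 0, radO_pos hq hq0, radO_pos hq hq0 0,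
        radO_zero_le_sqrt_mul_pi hq, hU, hAi⟩
  have h := abs_wH_diff2_le (N := Lc ^ (j + 1)) hκ₁0 hκ₁4 hκ₁D hA hR0pos hdet₁ hpair₁ κ l b c z
  refine h.trans ?_
  have hb0 := l1_nonneg b
  have hc0 := l1_nonneg c
  have hF0 := diff2Factor_nonneg (d := d) hR0pos.le
  -- the step factor: κ₁/N ≤ 1/(4N)
  set Nr : ℝ := ((Lc ^ (j + 1) : ℕ) : ℝ) with hNr
  have hstep : Real.exp (κ₁ / Nr * (l1 b + l1 c)) ≤ Real.exp ((l1 b + l1 c) / (4 * Nr)) := by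
    apply Real.exp_le_exp.2
    rw [show (l1 b + l1 c) / (4 * Nr) = (1 / 4) / Nr * (l1 b + l1 c) by field_simp]
    exact mul_le_mul_of_nonneg_right (div_le_div_of_nonneg_right hκ₁4 hN.le) (add_nonneg hb0 hc0)
  have hpow : (Nr ^ (d + 1 + 1))⁻¹ * (Nr * Real.sqrt Nr)⁻¹ = (Nr ^ (d + 3) * Real.sqrt Nr)⁻¹ := by
    rw [← mul_inv]; congr 1; ring
  calc _ = (Real.exp ((d + 1) * κ₁) * A * (4 * ((π + 1) * Real.sqrt (π + 1) + 10 * Real.sqrt 10 * (Real.sqrt 12 ^ (d + 1) * (Real.sqrt 6 * (1 + 8 * (d + 1 : ℕ)))) * (R0 ^ 2 * ((3 * π) ^ (1 - (1 / 2 : ℝ)) * (3 : ℝ) ^ (d + 1) * aliasConst (d + 1) (1 / 2)) + R0 ^ 3 * ((3 * π) ^ (1 - (-(1 / 2) : ℝ)) * (3 : ℝ) ^ (d + 1) * aliasConst (d + 1) (-(1 / 2)))))))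
          * ((Nr ^ (d + 1 + 1))⁻¹ * (Nr * Real.sqrt Nr)⁻¹)
          * (Real.sqrt (l1 b) * l1 c * Real.exp (κ₁ / Nr * (l1 b + l1 c)))
          * Real.exp (-(κ₁ * supNorm (quo (Lc ^ (j + 1)) z))) := by ring
    _ ≤ (Real.exp ((d + 1) * κ₁) * A * (4 * ((π + 1) * Real.sqrt (π + 1) + 10 * Real.sqrt 10 * (Real.sqrt 12 ^ (d + 1) * (Real.sqrt 6 * (1 + 8 * (d + 1 : ℕ)))) * (R0 ^ 2 * ((3 * π) ^ (1 - (1 / 2 : ℝ)) * (3 : ℝ) ^ (d + 1) * aliasConst (d + 1) (1 / 2)) + R0 ^ 3 * ((3 * π) ^ (1 - (-(1 / 2) : ℝ)) * (3 : ℝ) ^ (d + 1) * aliasConst (d + 1) (-(1 / 2)))))))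
          * ((Nr ^ (d + 1 + 1))⁻¹ * (Nr * Real.sqrt Nr)⁻¹)
          * (Real.sqrt (l1 b) * l1 c * Real.exp ((l1 b + l1 c) / (4 * Nr)))
          * Real.exp (-(κ₁ * supNorm (quo (Lc ^ (j + 1)) z))) := by
        apply mul_le_mul_of_nonneg_right _ (Real.exp_pos _).le
        apply mul_le_mul_of_nonneg_left _ (by positivity)
        exact mul_le_mul_of_nonneg_left hstep (by positivity)
    _ = _ := by rw [hpow]; ring

/-- [folklore] **(N1) ∧ (N1′) ∧ (N1″)_{1/2} JOINTLY AT `d = 3`, ONE COMMON DECAY RATE** — the three located leg-shape inputs of the PURE CELL of (LT-3) (leaf-01's (F)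
`LayerPushMoments.abs_second_diff_mul_le`: value `pa`, unit gradient `ga`, unit second difference `ha` — take `b = e_j`, `c = e_i`, `√‖b‖₁·‖c‖₁·e^{2/(4N)} ≤ e^{1/2}`):
leaf-16's `FineReadoutDecay.exists_wH_decay`, leaf-19's `exists_wH_grad_decay` and `exists_wH_diff2_decay` above at the smallest of their three rates. -/
theorem exists_wH_decay_grad_diff2 :
    ∃ κ₀ C C' C'' : ℝ, 0 < κ₀ ∧ 0 ≤ C ∧ 0 ≤ C' ∧ 0 ≤ C'' ∧
      (∀ (j : ℕ) (κ l : Fin (3 + 1)) (z : Fin (3 + 1) → ℤ), |wH (N := Lc ^ (j + 1)) κ l z| ≤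
        C * ((((Lc ^ (j + 1) : ℕ) : ℝ)) ^ (3 + 2))⁻¹ * Real.exp (-(κ₀ * supNorm (quo (Lc ^ (j + 1)) z)))) ∧
      (∀ (j : ℕ) (κ l : Fin (3 + 1)) (z : Fin (3 + 1) → ℤ) (ν : Fin (3 + 1)),
        |wH (N := Lc ^ (j + 1)) κ l (z + Pi.single ν 1) - wH (N := Lc ^ (j + 1)) κ l z| ≤
          C' * ((((Lc ^ (j + 1) : ℕ) : ℝ)) ^ (3 + 3))⁻¹ * Real.exp (-(κ₀ * supNorm (quo (Lc ^ (j + 1)) z)))) ∧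
      (∀ (j : ℕ) (κ l : Fin (3 + 1)) (z b c : Fin (3 + 1) → ℤ),
        |wH (N := Lc ^ (j + 1)) κ l (z + (b + c)) - wH (N := Lc ^ (j + 1)) κ l (z + b) - wH (N := Lc ^ (j + 1)) κ l (z + c)
            + wH (N := Lc ^ (j + 1)) κ l z|
          ≤ C'' * (Real.sqrt (l1 b) * l1 c * Real.exp ((l1 b + l1 c) / (4 * (((Lc ^ (j + 1) : ℕ) : ℝ)))))
            * ((((Lc ^ (j + 1) : ℕ) : ℝ)) ^ (3 + 3) * Real.sqrt (((Lc ^ (j + 1) : ℕ) : ℝ)))⁻¹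
            * Real.exp (-(κ₀ * supNorm (quo (Lc ^ (j + 1)) z)))) := by
  obtain ⟨κa, C, hκa, hC, hN1⟩ := exists_wH_decay (Lc := Lc)
  obtain ⟨κb, C', hκb, hC', hN1'⟩ := exists_wH_grad_decay (d := 3) (Lc := Lc)
  obtain ⟨κc, C'', hκc, hC'', hN1''⟩ := exists_wH_diff2_decay (d := 3) (Lc := Lc)
  refine ⟨min κa (min κb κc), C, C', C'', lt_min hκa (lt_min hκb hκc), hC, hC', hC'', fun j κ l z => ?_, fun j κ l z ν => ?_,
    fun j κ l z b c => ?_⟩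
  · refine (hN1 j κ l z).trans ?_
    exact mul_le_mul_of_nonneg_left (exp_neg_mul_le_of_le (min_le_left _ _) (supNorm_nonneg _)) (by positivity)
  · refine (hN1' j κ l z ν).trans ?_
    exact mul_le_mul_of_nonneg_left (exp_neg_mul_le_of_le ((min_le_right _ _).trans (min_le_left _ _)) (supNorm_nonneg _))
      (by positivity)
  · have hb0 := l1_nonneg b
    have hc0 := l1_nonneg c
    refine (hN1'' j κ l z b c).trans ?_
    exact mul_le_mul_of_nonneg_left (exp_neg_mul_le_of_le ((min_le_right _ _).trans (min_le_right _ _)) (supNorm_nonneg _))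
      (by positivity)

end Levels

end Summit.QuantumFields.BalabanUV.Beta.GAN24.FineReadoutSecondDiffDecay

end
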